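import Summits.QuantumAdvantage.QuantumAdvantage.Theorems.SosSandwichTransferPBLogQueries
import Summits.QuantumAdvantage.QuantumAdvantage.Theses.PromiseLift
import HarnessLib

/-!
# A conjecture-free variant of the SosSandwich assembly: a LOG-QUERY random-oracle separation and the promise lift give the summit

Route `SosSandwich` × `PromiseLift` × `RandomOracleGauge`; support for the hypothesis-type crux `RandomOracleHeurSeparation`
(stmt-QuantumAdvantage-1131).  The route's assembly is `AA_Q ∧ X_ROG ∧ PL ⟹ QuantumAdvantage` with `AA_Q` open.  By the
UNCONDITIONAL log-query transfer (`TransferPBGlue.logQueryTransfer`, Aaronson–Ambainis Thm. 26 in promise form, DFKO instead of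
any conjecture), the influence conjecture can be REMOVED if the random-oracle separation is witnessed by `O(log n)`-query machines:

* `plThesis_of_logQuerySeparation` — `X_ROG[log] → PromiseLift.PlThesis` (a log-query average-case random-oracle separation proves
  `PromiseBQP ⊄ PromiseBPP'` outright);
* `quantumAdvantage_of_logQuerySeparation` — `X_ROG[log] → PromiseLift.PlLift → QuantumAdvantage` (∘ `PromiseLift.closes`);
* `randomOracleHeurSeparation_of_logQuerySeparation` — `X_ROG[log] → X_ROG` (the log-query event is contained in the full one,
  `BQP^{A[log]} ⊆ BQP^A`), so `X_ROG[log]` is a STRENGTHENING of the registered crux, not a new direction.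

`X_ROG[log]` is written inline: `¬ ∀ᵐ A, ∀ c F, F uniform with ≤ c·log₂ n + c oracle gates → (F^A decides L with bounded error →
L ∈ AvgP^A)`.  Honest label: compositions; `X_ROG[log]` is at least as hard to establish as `X_ROG` (hypothesis-type).
Sources: AaronsonAmbainis2014 Thm. 26; Goldreich2011 §1.
-/

noncomputable section

-- D-0017: single-conjunct summit ⇒ the duplicate `QuantumAdvantage.QuantumAdvantage` is mandated.
set_option linter.dupNamespace false

namespace Summit.QuantumAdvantage.QuantumAdvantage.Theorems.SosSandwich.TransferPBGlue

open MeasureTheory Literature.Computability.Complexity Literature.Computability.Cryptography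
  Literature.Computability.QuantumComplexity
open Summit.QuantumAdvantage.QuantumAdvantage.Theses

/-- **A log-query random-oracle separation proves PromiseLift's thesis X, unconditionally**: if it is NOT the case that for
almost every `A` every uniform `O(log n)`-query family decides only `AvgP^A` languages, then `PromiseBQP ⊄ PromiseBPP'`
(contrapositive of `logQueryTransfer`). [cite: AaronsonAmbainis2014, Thm. 26] -/
theorem plThesis_of_logQuerySeparation
    (h : ¬ ∀ᵐ A ∂randomOracleMeasure, ∀ (c : ℕ) (F : QCircuitFamily cliffordT), F.IsUniform →
      (∀ n, ((F.circ n).gates.filter (fun g => ¬ g.IsOracleFree)).length ≤ c * Nat.log 2 n + c) →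
      ∀ L : Language Bool, (∀ x, (x ∈ L → 2 / 3 ≤ F.acceptProbOn (A : Language Bool) x) ∧
        (x ∉ L → F.acceptProbOn A x ≤ 1 / 3)) →
        L ∈ Literature.Barriers.QuantumAdvantage.AvgPRel (Oracle.ofLanguage (A : Language Bool))) :
    PromiseLift.PlThesis :=
  fun hPr => h (logQueryTransfer hPr)

/-- **The summit from a log-query random-oracle separation and the promise lift — no influence conjecture**
(`PromiseLift.closes ∘ plThesis_of_logQuerySeparation`). [cite: AaronsonAmbainis2014, Thm. 26] [cite: Goldreich2011, §1] -/
theorem quantumAdvantage_of_logQuerySeparation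
    (h : ¬ ∀ᵐ A ∂randomOracleMeasure, ∀ (c : ℕ) (F : QCircuitFamily cliffordT), F.IsUniform →
      (∀ n, ((F.circ n).gates.filter (fun g => ¬ g.IsOracleFree)).length ≤ c * Nat.log 2 n + c) →
      ∀ L : Language Bool, (∀ x, (x ∈ L → 2 / 3 ≤ F.acceptProbOn (A : Language Bool) x) ∧
        (x ∉ L → F.acceptProbOn A x ≤ 1 / 3)) →
        L ∈ Literature.Barriers.QuantumAdvantage.AvgPRel (Oracle.ofLanguage (A : Language Bool)))
    (hL : PromiseLift.PlLift) : _root_.QuantumAdvantage :=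
  PromiseLift.closes (plThesis_of_logQuerySeparation h) hL

/-- **`X_ROG[log]` strengthens the registered crux `X_ROG`** (stmt-1131, RandomOracleGauge spelling): the almost-sure full
collapse `BQP^A ⊆ AvgP^A` contains the log-query collapse, so denying the latter denies the former. [folklore] -/
theorem randomOracleHeurSeparation_of_logQuerySeparation
    (h : ¬ ∀ᵐ A ∂randomOracleMeasure, ∀ (c : ℕ) (F : QCircuitFamily cliffordT), F.IsUniform →
      (∀ n, ((F.circ n).gates.filter (fun g => ¬ g.IsOracleFree)).length ≤ c * Nat.log 2 n + c) →
      ∀ L : Language Bool, (∀ x, (x ∈ L → 2 / 3 ≤ F.acceptProbOn (A : Language Bool) x) ∧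
        (x ∉ L → F.acceptProbOn A x ≤ 1 / 3)) →
        L ∈ Literature.Barriers.QuantumAdvantage.AvgPRel (Oracle.ofLanguage (A : Language Bool))) :
    RandomOracleGauge.RandomOracleHeurSeparation := by
  intro hall
  refine h ?_
  filter_upwards [hall] with A hA
  intro c F hF _ L hL
  exact hA ⟨F, hF, hL⟩

end Summit.QuantumAdvantage.QuantumAdvantage.Theorems.SosSandwich.TransferPBGlue

end
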